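import Literature.Topology.FourManifolds.InfiniteCyclicCover
import Literature.Topology.FourManifolds.AlexanderModuleTrivializer
import Literature.AlgebraicTopology.SingularHomology.HurewiczProofs
import HarnessLib

/-!
# The Alexander module is the first homology of the infinite cyclic cover

Topic `Literature/Topology/FourManifolds`; second module (after `InfiniteCyclicCover.lean`) of the
covering-space road to the Seifert presentation of the Alexander module of a knot group (the
geometric half of the named facts `Literature.Topology.FourManifolds.exists_eq_mul_invert_of_isSmoothlySlice`,
`exists_eq_mul_invert_of_isTopologicallySlice` and `Knot.exists_isAlexanderPolynomial`).

The tree's Alexander module of a group `G` is the intrinsic one, `G'/G''` with `Gᵃᵇ` acting by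
conjugation (`Literature.Topology.FourManifolds.alexanderModule`, Crowell–Fox Ch. VIII §3; Rolfsen
§7.B). The textbook computation of it for a knot group (D. Rolfsen, *Knots and Links* (1976),
§7.A–C and §8.C; W. B. R. Lickorish, *An Introduction to Knot Theory* (1997), Ch. 6, Thm. 6.5 with
Def. 6.2 ff.; A. Hatcher, *Algebraic Topology* (2002), §1.3 and Thm. 2A.1) passes through the
**infinite cyclic cover** `X̃ → X` of the knot complement `X`: `π₁(X̃) = G'`, so by the Hurewicz
theorem `H₁(X̃; ℤ) = G'/G''`, and under this identification conjugation by a meridian is the deck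
transformation. This file proves exactly that, for the cover `CircleMaps.CyclicCover f` of an
arbitrary space `X` defined by a circle-valued map `f : X → S¹` (`InfiniteCyclicCover.lean`) at a
base point `x₀`, writing `W = CircleMaps.windingHom f x₀ : π₁(X, x₀) → ℤ`:

* `loopClass_conj_path` — base-point change does not alter Hurewicz classes:
  `h(δ · β · δ⁻¹) = h(β)` in `H₁` for a path `δ` and a loop `β` at its end point (Hatcher,
  proof of Thm. 2A.1; a chain-level computation with the `2`-simplices of `HurewiczOne.lean`);
* `CyclicCover.kerHurewicz f x₀ : ker W →* H₁(X̃; ℤ)` — the composite of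
  `π₁(X̃, ẽ₀) ≃* ker W` (`CyclicCover.fundamentalGroupEquivKer`) with the Hurewicz homomorphism of
  the cover; on the class of a loop `β` of winding number `0` it is the Hurewicz class of the lifted
  loop `β̃` (`kerHurewicz_mk`);
* `CyclicCover.kerHurewicz_conj` — **equivariance**: for `g ∈ π₁(X, x₀)` and `h ∈ ker W`,
  `kerHurewicz (g h g⁻¹) = (τ₋w)_* (kerHurewicz h)` with `w = W g` and `τₖ` the deck transformation
  `k +ᵥ ·` (with Mathlib's multiplication of loops `p * q = q.trans p`, `g h g⁻¹` is the loop
  `γ⁻¹ · β · γ`, whose lift from `ẽ₀` runs down to `(-w) +ᵥ ẽ₀`, around the translate of `β̃`, and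
  back);
* `CyclicCover.kerHurewicz_surjective`, `ker_kerHurewicz` — for `X` path connected with a loop
  of winding number `1` (so that `X̃` is path connected), `kerHurewicz` is onto with kernel the
  commutator subgroup of `ker W` (Hurewicz, `HurewiczProofs.lean`);
* `CyclicCover.alexanderModuleEquiv` — if moreover `ker W = [π₁, π₁]` (i.e. `f_*` is the
  abelianisation, as for a knot complement and the circle-valued map of a `0`-framed tube), the
  **additive isomorphism `alexanderModule (π₁(X, x₀)) ≃+ H₁(X̃; ℤ)`** sending the class of
  `h = [β] ∈ G'` to the Hurewicz class of `β̃` (`alexanderModuleEquiv_mk`), under which the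
  group-ring element of `g` acts as `(τ₋w)_*`, `w = W g` (`alexanderModuleEquiv_of_smul`,
  `alexanderModuleEquiv_single_smul`).

Everything is proved; no named fact is introduced. The only new data are the monoid
homomorphism `kerHurewicz`, the bundled deck transformation `deck` and the isomorphism.

## References

* D. Rolfsen, *Knots and Links*, Publish or Perish (1976), §7.A–C, §8.C. [Rolfsen1976]
* W. B. R. Lickorish, *An Introduction to Knot Theory*, GTM 175 (1997), Ch. 6. [Lickorish1997]
* A. Hatcher, *Algebraic Topology*, CUP (2002), §1.3 Props. 1.31, 1.39, 1.40; §2.A Thm. 2A.1.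
  [HatcherAT2002]
* R. H. Crowell, R. H. Fox, *Introduction to Knot Theory* (1963), Ch. VIII §3. [CrowellFox1963]

## Design notes

* The sign `-w`: Mathlib's `FundamentalGroup` multiplies by `p * q = q.trans p`, so
  `MulAut.conjNormal g` (used by `alexanderRep`) conjugates by the *reversed* loop; with the deck
  action `k +ᵥ (x, s) = (x, s + 2πk)` and monodromy `=` winding number
  (`CyclicCover.monodromy_eq`) this yields the deck transformation by `-W g`. Since
  `Knot.IsAlexanderPolynomial` quantifies over all isomorphisms `Gᵃᵇ ≃* ℤ`, the sign is immaterial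
  downstream (compose with inversion on `ℤ`).
* The homology side is Mathlib's singular homology through the tree's `Literature.singularHomology`
  (`HurewiczOne.lean`, `HurewiczProofs.lean`); maps on `H₁` are applied as morphisms of
  `ModuleCat ℤ`, exactly as in `map_loopClass`.
-/

noncomputable section

-- see the implementation notes of `SingularChainsConcrete.lean` / `HurewiczProofs.lean`
set_option backward.isDefEq.respectTransparency false

open Set Function
open scoped unitInterval Real
open Literature.AlgebraicTopology.SingularHomology

universe u

namespace Literature.Topology.FourManifolds

/-- Local notation for the homotopy class of a path (Mathlib's simp normal form
`Path.Homotopic.Quotient.mk`). -/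
local notation "⟦" p "⟧ₚ" => Path.Homotopic.Quotient.mk p

/-! ### Base-point change for Hurewicz classes -/

section Hurewicz

open SingularSimplex singularChainComplex

variable {Y : Type u} [TopologicalSpace Y]

/-- **Hurewicz classes are insensitive to base-point change**: for a path `δ` from `a` to `b` and a
loop `β` at `b`, the loop `δ · β · δ⁻¹` at `a` has the same class in `H₁(Y; M)` as `β`. At chain
level `δ(βδ⁻¹) ≡ δ + βδ⁻¹ ≡ δ + β + δ⁻¹` modulo the boundaries of the `2`-simplices of the
concatenations, and `δ + δ⁻¹ ≡ δδ⁻¹ ≡ refl ≡ 0` by the homotopy `δδ⁻¹ ≃ refl` and the constant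
`2`-simplex (Hatcher 2002, proof of Thm. 2A.1). [cite: HatcherAT2002, Thm. 2A.1] -/
theorem loopClass_conj_path (R : Type) [CommRing R] (M : Type) [AddCommGroup M] [Module R M]
    (m : M) {a b : Y} (δ : Path a b) (β : Path b b) :
    loopClass R M m (δ.trans (β.trans δ.symm)) = loopClass R M m β := by
  rw [loopClass, loopClass, homologyCls_eq_homologyCls_iff,
    exists_d_prev_eq_iff (i := 2) (ChainComplex.prev ℕ 1)]
  refine ⟨single (R := R) (const₂ a) m +
      homotopyChain R M m (Path.Homotopy.reflTransSymm δ).symm +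
      single (R := R) (ofTrans δ δ.symm) m - single (R := R) (ofTrans δ (β.trans δ.symm)) m -
      single (R := R) (ofTrans β δ.symm) m, ?_⟩
  rw [map_sub, map_sub, map_add, map_add, d_single_const₂, d_homotopyChain, d_single_ofTrans,
    d_single_ofTrans, d_single_ofTrans]
  abel

end Hurewicz

namespace CircleMaps

namespace CyclicCover

variable {X : Type u} [TopologicalSpace X] (f : C(X, Circle)) (x₀ : X)

/-! ### Deck transformations on homology; lifted loops -/

/-- The deck transformation `k +ᵥ ·` as a bundled continuous map. [folklore] -/
def deck (k : ℤ) : C(CyclicCover f, CyclicCover f) := ⟨(k +ᵥ ·), continuous_const_vadd k⟩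

/-- `deck` is the deck transformation. [folklore] -/
@[simp] theorem deck_apply (k : ℤ) (p : CyclicCover f) : deck f k p = k +ᵥ p := rfl

variable {f x₀}

/-- **The lift of a loop of winding number zero is a loop** at the base point `ẽ₀ = base f x₀`
(Hatcher 2002, Prop. 1.31). [cite: HatcherAT2002, §1.3 Prop. 1.31] -/
def liftLoop (β : Path x₀ x₀) (h : winding f β = 0) : Path (base f x₀) (base f x₀) :=
  (liftPath β (base f x₀) rfl).cast rfl (by rw [liftEnd_eq_vadd, h, zero_vadd])

/-- The lifted loop lifts `β`. [folklore] -/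
@[simp] theorem proj_liftLoop (β : Path x₀ x₀) (h : winding f β = 0) (t : I) :
    proj (liftLoop β h t) = β t := rfl

/-- The lifted loop projects to `β`. [folklore] -/
theorem map_liftLoop (β : Path x₀ x₀) (h : winding f β = 0) :
    (liftLoop β h).map continuous_proj = β := by
  ext t
  rfl

/-- A loop whose class lies in the kernel of the winding homomorphism has winding number zero.
[folklore] -/
theorem winding_eq_zero_of_mem_ker {β : Path x₀ x₀}
    (hβ : FundamentalGroup.fromPath ⟦β⟧ₚ ∈ (windingHom f x₀).ker) : winding f β = 0 := by
  rw [MonoidHom.mem_ker, windingHom_fromPath] at hβ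
  exact Multiplicative.ofAdd.injective hβ

/-- `proj_*` sends the class of the lifted loop back to the class of the loop. [folklore] -/
theorem fundamentalGroupEquivKer_liftLoop (β : Path x₀ x₀) (h : winding f β = 0)
    (hβ : FundamentalGroup.fromPath ⟦β⟧ₚ ∈ (windingHom f x₀).ker) :
    fundamentalGroupEquivKer (base f x₀) (FundamentalGroup.fromPath ⟦liftLoop β h⟧ₚ) =
      ⟨FundamentalGroup.fromPath ⟦β⟧ₚ, hβ⟩ := by
  apply Subtype.ext
  rw [coe_fundamentalGroupEquivKer, mapOfEq_fromPath, map_liftLoop]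

variable (f x₀)

/-! ### The Hurewicz homomorphism on the kernel of the winding homomorphism -/

/-- **The Hurewicz homomorphism of the infinite cyclic cover, read on `ker W ≤ π₁(X, x₀)`**:
`ker W ≃* π₁(X̃, ẽ₀) → H₁(X̃; ℤ)` (inverse of `CyclicCover.fundamentalGroupEquivKer` followed by
the Hurewicz homomorphism `Literature.AlgebraicTopology.SingularHomology.hurewiczOne` of the cover at `ẽ₀ = base f x₀`;
Rolfsen 1976, §7.A; Hatcher 2002, Thm. 2A.1). [cite: Rolfsen1976, §7.A] -/
def kerHurewicz :
    (windingHom f x₀).ker →* Multiplicative (singularHomology ℤ ℤ (CyclicCover f) 1) :=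
  (hurewiczOne ℤ ℤ (1 : ℤ) (base f x₀)).comp
    (fundamentalGroupEquivKer (f := f) (base f x₀)).symm.toMonoidHom

variable {f x₀}

/-- `kerHurewicz` on the projection of a loop of the cover is its Hurewicz class. [folklore] -/
theorem kerHurewicz_apply_equiv (Γ : FundamentalGroup (CyclicCover f) (base f x₀)) :
    kerHurewicz f x₀ (fundamentalGroupEquivKer (base f x₀) Γ) =
      hurewiczOne ℤ ℤ (1 : ℤ) (base f x₀) Γ := by
  simp [kerHurewicz]

/-- **`kerHurewicz [β] = h(β̃)`**: on the class of a loop `β` of winding number `0`, `kerHurewicz`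
is the Hurewicz class of the lifted loop `β̃` at `ẽ₀`. [folklore] -/
theorem kerHurewicz_mk (β : Path x₀ x₀)
    (hβ : FundamentalGroup.fromPath ⟦β⟧ₚ ∈ (windingHom f x₀).ker) :
    kerHurewicz f x₀ ⟨FundamentalGroup.fromPath ⟦β⟧ₚ, hβ⟩ =
      Multiplicative.ofAdd (loopClass ℤ ℤ (1 : ℤ)
        (liftLoop β (winding_eq_zero_of_mem_ker hβ))) := by
  rw [← fundamentalGroupEquivKer_liftLoop β (winding_eq_zero_of_mem_ker hβ) hβ,
    kerHurewicz_apply_equiv, hurewiczOne_fromPath]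

/-! ### Equivariance: conjugation versus deck transformations -/

/-- Projection of a concatenation of paths in the cover. [folklore] -/
theorem proj_trans_apply {e₁ e₂ e₃ : CyclicCover f} {y₁ y₂ y₃ : X} (P : Path e₁ e₂) (Q : Path e₂ e₃)
    (p : Path y₁ y₂) (q : Path y₂ y₃) (hP : ∀ t, proj (P t) = p t) (hQ : ∀ t, proj (Q t) = q t)
    (t : I) : proj ((P.trans Q) t) = (p.trans q) t := by
  rw [Path.trans_apply, Path.trans_apply]
  split_ifs <;> simp [hP, hQ]

/-- Projection of a reversed path in the cover. [folklore] -/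
theorem proj_symm_apply {e₁ e₂ : CyclicCover f} {y₁ y₂ : X} (P : Path e₁ e₂) (p : Path y₁ y₂)
    (hP : ∀ t, proj (P t) = p t) (t : I) : proj (P.symm t) = p.symm t :=
  hP (σ t)

/-- In `π₁(X, x₀)`, `[γ] * [β] * [γ]⁻¹` is the class of the loop `γ⁻¹ · β · γ` (Mathlib multiplies
loops in the reverse order, `p * q = q.trans p`). [folklore] -/
theorem fromPath_mul_fromPath_mul_inv (γ β : Path x₀ x₀) :
    FundamentalGroup.fromPath ⟦γ⟧ₚ * FundamentalGroup.fromPath ⟦β⟧ₚ *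
        (FundamentalGroup.fromPath ⟦γ⟧ₚ)⁻¹ =
      FundamentalGroup.fromPath ⟦γ.symm.trans (β.trans γ)⟧ₚ := by
  rw [FundamentalGroup.mul_def, FundamentalGroup.mul_def, FundamentalGroup.inv_def]
  rfl

/-- A conjugate of an element of `ker W` lies in `ker W` (the kernel is normal). [folklore] -/
theorem conj_mem_ker (g : FundamentalGroup X x₀) (h : (windingHom f x₀).ker) :
    g * h * g⁻¹ ∈ (windingHom f x₀).ker :=
  (MonoidHom.normal_ker _).conj_mem _ h.2 g

/-- **Equivariance of `kerHurewicz` on loops.** For loops `γ`, `β` at `x₀` with `winding f β = 0`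
and `w = winding f γ`, the Hurewicz class of the lift of `γ⁻¹ · β · γ` at `ẽ₀` is `(τ₋w)_*` of the
class of the lift `β̃` of `β`: the lift runs along the lift `δ` of `γ⁻¹` down to `(-w) +ᵥ ẽ₀`, around
the translate `(-w) +ᵥ β̃`, and back along `δ⁻¹` (uniqueness of lifts), and base-point change does
not alter Hurewicz classes (`loopClass_conj_path`) (Rolfsen 1976, §7.A: "the action of `t`
corresponds to the covering translation"). [cite: Rolfsen1976, §7.A] -/
theorem loopClass_liftLoop_conj (γ β : Path x₀ x₀) (hβ : winding f β = 0)
    (hl : winding f (γ.symm.trans (β.trans γ)) = 0) :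
    loopClass ℤ ℤ (1 : ℤ) (liftLoop (γ.symm.trans (β.trans γ)) hl) =
      singularHomology.map ℤ ℤ (deck f (-winding f γ)) 1 (loopClass ℤ ℤ (1 : ℤ) (liftLoop β hβ)) := by
  -- the lift `δ` of `γ⁻¹` from `ẽ₀`, ending at `(-w) +ᵥ ẽ₀`
  have hend : liftEnd γ.symm (base f x₀) rfl = (-winding f γ) +ᵥ base f x₀ := by
    rw [liftEnd_eq_vadd, winding_symm]
  let δ : Path (base f x₀) ((-winding f γ) +ᵥ base f x₀) :=
    (liftPath γ.symm (base f x₀) rfl).cast rfl hend.symm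
  -- the translated lift of `β`, a loop at `(-w) +ᵥ ẽ₀`
  let β₁ : Path ((-winding f γ) +ᵥ base f x₀) ((-winding f γ) +ᵥ base f x₀) :=
    (liftLoop β hβ).map (deck f (-winding f γ)).continuous
  have hδ : ∀ t, proj (δ t) = γ.symm t := fun t => rfl
  have hβ₁ : ∀ t, proj (β₁ t) = β t := fun t => rfl
  -- the lifted loop of `γ⁻¹ β γ` is `δ · β₁ · δ⁻¹`
  have hL : ∀ t, liftLoop (γ.symm.trans (β.trans γ)) hl t = (δ.trans (β₁.trans δ.symm)) t := by
    refine path_eq_of_proj_eq _ _ fun t => ?_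
    rw [proj_liftLoop, proj_trans_apply δ (β₁.trans δ.symm) γ.symm (β.trans γ.symm.symm) hδ
      (proj_trans_apply β₁ δ.symm β γ.symm.symm hβ₁ (proj_symm_apply δ γ.symm hδ)) t]
    simp only [Path.symm_symm]
  have hL' : liftLoop (γ.symm.trans (β.trans γ)) hl = δ.trans (β₁.trans δ.symm) :=
    Path.ext (funext hL)
  rw [hL', loopClass_conj_path, map_loopClass]

/-- **Equivariance of `kerHurewicz`**: conjugation by `g ∈ π₁(X, x₀)` on `ker W` becomes the deck
transformation by `-W g` on `H₁(X̃; ℤ)` (Rolfsen 1976, §7.A; Lickorish 1997, Ch. 6; the sign is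
explained in the module docstring). [cite: Rolfsen1976, §7.A] -/
theorem kerHurewicz_conj (g : FundamentalGroup X x₀) (h : (windingHom f x₀).ker) :
    kerHurewicz f x₀ ⟨g * h * g⁻¹, conj_mem_ker g h⟩ =
      Multiplicative.ofAdd (singularHomology.map ℤ ℤ
        (deck f (-Multiplicative.toAdd (windingHom f x₀ g))) 1
        (Multiplicative.toAdd (kerHurewicz f x₀ h))) := by
  obtain ⟨h, hh⟩ := h
  induction g using Quotient.inductionOn with | h γ => ?_
  induction h using Quotient.inductionOn with | h β => ?_
  have hβ : winding f β = 0 := winding_eq_zero_of_mem_ker hh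
  have hmem : FundamentalGroup.fromPath ⟦γ.symm.trans (β.trans γ)⟧ₚ ∈ (windingHom f x₀).ker := by
    rw [← fromPath_mul_fromPath_mul_inv]
    exact conj_mem_ker _ ⟨_, hh⟩
  have hl : winding f (γ.symm.trans (β.trans γ)) = 0 := winding_eq_zero_of_mem_ker hmem
  have h1 : (⟨FundamentalGroup.fromPath ⟦γ⟧ₚ * FundamentalGroup.fromPath ⟦β⟧ₚ *
      (FundamentalGroup.fromPath ⟦γ⟧ₚ)⁻¹, conj_mem_ker _ ⟨_, hh⟩⟩ : (windingHom f x₀).ker) =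
      ⟨FundamentalGroup.fromPath ⟦γ.symm.trans (β.trans γ)⟧ₚ, hmem⟩ :=
    Subtype.ext (fromPath_mul_fromPath_mul_inv γ β)
  change kerHurewicz f x₀ ⟨FundamentalGroup.fromPath ⟦γ⟧ₚ * FundamentalGroup.fromPath ⟦β⟧ₚ *
      (FundamentalGroup.fromPath ⟦γ⟧ₚ)⁻¹, conj_mem_ker _ ⟨_, hh⟩⟩ = Multiplicative.ofAdd
    (singularHomology.map ℤ ℤ (deck f (-Multiplicative.toAdd (windingHom f x₀
      (FundamentalGroup.fromPath ⟦γ⟧ₚ)))) 1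
      (Multiplicative.toAdd (kerHurewicz f x₀ ⟨FundamentalGroup.fromPath ⟦β⟧ₚ, hh⟩)))
  rw [h1, kerHurewicz_mk _ hmem, kerHurewicz_mk _ hh, windingHom_fromPath, toAdd_ofAdd, toAdd_ofAdd,
    loopClass_liftLoop_conj γ β hβ hl]

/-! ### Surjectivity and kernel (Hurewicz) -/

section Hurewicz

variable [PathConnectedSpace X] {γ₀ : Path x₀ x₀}

/-- **`kerHurewicz` is onto** when `X` is path connected and some loop winds once (then the cover
is path connected, `CyclicCover.pathConnectedSpace_of_winding_eq_one`, and the Hurewicz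
homomorphism of the cover is onto, Hatcher Thm. 2A.1). [cite: HatcherAT2002, Thm. 2A.1] -/
theorem kerHurewicz_surjective (h₀ : winding f γ₀ = 1) : Surjective (kerHurewicz f x₀) := by
  haveI := pathConnectedSpace_of_winding_eq_one (f := f) γ₀ h₀
  exact (HurewiczProof.hurewiczOne_surjective (base f x₀)).comp
    (fundamentalGroupEquivKer (f := f) (base f x₀)).symm.surjective

/-- The Hurewicz homomorphism `π₁(X̃, ẽ₀)ᵃᵇ → H₁(X̃; ℤ)` of the cover is bijective when `X` is
path connected and some loop winds once (the cover is then path connected; Hatcher Thm. 2A.1,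
`HurewiczProofs.lean`). [cite: HatcherAT2002, Thm. 2A.1] -/
theorem hurewiczOneAb_base_bijective (h₀ : winding f γ₀ = 1) :
    Bijective (hurewiczOneAb ℤ ℤ (1 : ℤ) (base f x₀)) := by
  haveI := pathConnectedSpace_of_winding_eq_one (f := f) γ₀ h₀
  exact ⟨HurewiczProof.hurewiczOneAb_injective _, HurewiczProof.hurewiczOneAb_surjective _⟩

/-- **`(ker W)ᵃᵇ ≃* H₁(X̃; ℤ)`**: the abelianisation of `ker W ≃* π₁(X̃, ẽ₀)` is identified with
the first homology of the (path-connected) cover by the Hurewicz isomorphism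
(Hatcher Thm. 2A.1). [cite: HatcherAT2002, Thm. 2A.1] -/
def kerAbEquiv (h₀ : winding f γ₀ = 1) :
    Abelianization (windingHom f x₀).ker ≃* Multiplicative (singularHomology ℤ ℤ (CyclicCover f) 1) :=
  (fundamentalGroupEquivKer (f := f) (base f x₀)).symm.abelianizationCongr.trans
    (MulEquiv.ofBijective (hurewiczOneAb ℤ ℤ (1 : ℤ) (base f x₀)) (hurewiczOneAb_base_bijective h₀))

/-- `kerAbEquiv` on the class of `h ∈ ker W` is `kerHurewicz h`. [folklore] -/
@[simp]
theorem kerAbEquiv_of (h₀ : winding f γ₀ = 1) (h : (windingHom f x₀).ker) :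
    kerAbEquiv h₀ (Abelianization.of h) = kerHurewicz f x₀ h :=
  rfl

/-- **The kernel of `kerHurewicz` is the commutator subgroup of `ker W`** (Hatcher Thm. 2A.1,
transported along `π₁(X̃, ẽ₀) ≃* ker W`). [cite: HatcherAT2002, Thm. 2A.1] -/
theorem ker_kerHurewicz (h₀ : winding f γ₀ = 1) :
    (kerHurewicz f x₀).ker = commutator (windingHom f x₀).ker := by
  ext h
  rw [MonoidHom.mem_ker, ← kerAbEquiv_of h₀, MulEquiv.map_eq_one_iff, ← MonoidHom.mem_ker,
    Abelianization.ker_of]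

end Hurewicz

/-! ### The Alexander module of `π₁(X, x₀)` -/

section AlexanderModule

variable [PathConnectedSpace X] {γ₀ : Path x₀ x₀}

/-- **The Alexander module is the first homology of the infinite cyclic cover.** Let `X` be path
connected, `f : X → S¹` continuous, `x₀ ∈ X`, and suppose some loop has winding number `1` and
the kernel of the winding homomorphism `W = f_* : π₁(X, x₀) → ℤ` is the commutator subgroup (i.e.
`f_*` is the abelianisation; for a knot complement and the circle-valued map of a `0`-framed tube
this is `[γ]ᵃᵇ = [meridian]ᵃᵇ ^ W γ`). Then the Alexander module `G'/G''` of `G = π₁(X, x₀)`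
(`Literature.Topology.FourManifolds.alexanderModule`) is additively isomorphic to `H₁(X̃; ℤ)`,
`X̃ = CyclicCover f`, by `[h] ↦ h(β̃)` for `h = [β] ∈ G'` with lifted loop `β̃` at `ẽ₀`
(`alexanderModuleEquiv_mk`); the module structure goes over to the deck transformations
(`alexanderModuleEquiv_of_smul`). Rolfsen 1976, §7.A ("`H₁(X̃)` as a `Λ`-module … is the
Alexander invariant"), §7.B–C; Lickorish 1997, Ch. 6; via Hatcher Props. 1.31, 1.40 and
Thm. 2A.1. [cite: Rolfsen1976, §7.A–C] -/
def alexanderModuleEquiv (h₀ : winding f γ₀ = 1)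
    (hker : (windingHom f x₀).ker = commutator (FundamentalGroup X x₀)) :
    alexanderModule (FundamentalGroup X x₀) ≃+ singularHomology ℤ ℤ (CyclicCover f) 1 :=
  (alexanderRep (FundamentalGroup X x₀)).asModuleEquiv.toAddEquiv.trans
    (MulEquiv.toAdditiveLeft
      (((MulEquiv.subgroupCongr hker.symm).abelianizationCongr).trans (kerAbEquiv h₀)))

variable {h₀ : winding f γ₀ = 1} {hker : (windingHom f x₀).ker = commutator (FundamentalGroup X x₀)}

/-- `alexanderModuleEquiv` on the class of `h ∈ G'` is `kerHurewicz h`. [folklore] -/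
theorem alexanderModuleEquiv_mk (h : commutator (FundamentalGroup X x₀)) :
    alexanderModuleEquiv h₀ hker (alexanderModule.mk h) =
      Multiplicative.toAdd (kerHurewicz f x₀ ⟨h, hker.symm ▸ h.2⟩) := by
  rw [alexanderModuleEquiv, alexanderModule.mk, AddEquiv.trans_apply]
  change MulEquiv.toAdditiveLeft _ (Additive.ofMul (Abelianization.of h)) = _
  rw [MulEquiv.toAdditiveLeft, AddEquiv.toMultiplicativeRight_symm_apply_apply,
    MonoidHom.toAdditiveLeft_apply_apply, toMul_ofMul, MulEquiv.coe_toMonoidHom,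
    MulEquiv.trans_apply, abelianizationCongr_of, kerAbEquiv_of]
  rfl

/-- **`alexanderModuleEquiv [β] = h(β̃)`**: on the class of a loop `β` whose class lies in `G'` (so
of winding number `0`), the isomorphism is the Hurewicz class of the lifted loop `β̃` at `ẽ₀`
(Rolfsen 1976, §7.A). [cite: Rolfsen1976, §7.A] -/
theorem alexanderModuleEquiv_mk_fromPath (β : Path x₀ x₀)
    (hβ : FundamentalGroup.fromPath ⟦β⟧ₚ ∈ commutator (FundamentalGroup X x₀)) :
    alexanderModuleEquiv h₀ hker (alexanderModule.mk ⟨FundamentalGroup.fromPath ⟦β⟧ₚ, hβ⟩) =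
      loopClass ℤ ℤ (1 : ℤ) (liftLoop β (winding_eq_zero_of_mem_ker (hker.symm ▸ hβ))) := by
  rw [alexanderModuleEquiv_mk]
  exact congrArg Multiplicative.toAdd (kerHurewicz_mk β (hker.symm ▸ hβ))

/-- **The module structure goes over to the deck transformations**: under `alexanderModuleEquiv`
the group-ring element of `g ∈ π₁(X, x₀)` (acting on `G'/G''` by conjugation) acts on `H₁(X̃; ℤ)`
as the deck transformation `τ₋w`, `w = W g` (Rolfsen 1976, §7.A; sign conventions in the module
docstring). [cite: Rolfsen1976, §7.A] -/
theorem alexanderModuleEquiv_of_smul (g : FundamentalGroup X x₀)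
    (m : alexanderModule (FundamentalGroup X x₀)) :
    alexanderModuleEquiv h₀ hker
        (MonoidAlgebra.of ℤ _ (Abelianization.of g) • m) =
      singularHomology.map ℤ ℤ (deck f (-Multiplicative.toAdd (windingHom f x₀ g))) 1
        (alexanderModuleEquiv h₀ hker m) := by
  obtain ⟨h, rfl⟩ := alexanderModule.mk_surjective m
  rw [alexanderModule.of_smul_mk, alexanderModuleEquiv_mk, alexanderModuleEquiv_mk]
  have hmem : (h : FundamentalGroup X x₀) ∈ (windingHom f x₀).ker := hker.symm ▸ h.2
  have := kerHurewicz_conj g ⟨h, hmem⟩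
  rw [← toAdd_ofAdd (singularHomology.map ℤ ℤ _ 1 _), ← this]
  rfl

/-- The same for the general group-ring generator `single [g] r`: it acts as `r · (τ₋w)_*`.
[folklore] -/
theorem alexanderModuleEquiv_single_smul (g : FundamentalGroup X x₀) (r : ℤ)
    (m : alexanderModule (FundamentalGroup X x₀)) :
    alexanderModuleEquiv h₀ hker (MonoidAlgebra.single (Abelianization.of g) r • m) =
      r • singularHomology.map ℤ ℤ (deck f (-Multiplicative.toAdd (windingHom f x₀ g))) 1
        (alexanderModuleEquiv h₀ hker m) := by
  rw [← alexanderModuleEquiv_of_smul, ← map_zsmul (alexanderModuleEquiv h₀ hker),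
    MonoidAlgebra.of_apply, ← smul_assoc, MonoidAlgebra.smul_single', mul_one]

end AlexanderModule

end CyclicCover

end CircleMaps

end Literature.Topology.FourManifolds
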